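import Summits.CriticalPhenomena.PercolationContinuityZ3.Theorems.PercNearOneGluingNoHeavyLowerTailTwoPortPeelingTwoStars
import Summits.CriticalPhenomena.PercolationContinuityZ3.Theorems.PercNearOneGluingNoHeavyLowerTailTwoPortPeelingLevelTwoAssembly
import HarnessLib

/-!
# `NoHeavyLowerTail` (stmt-CriticalPhenomena-4575) — MS-STAR for two two-port stars at level `j ≤ 2`, unconditional

Route `PercNearOneGluingNoHeavy`, seat `prim-gen-swap` (gen 5); memo TWO-PORT-PEELING.md §5.  Combining the reduction
`championStabilityPair_twoStars_of_comonotone` (two-port peeling at both hubs, P1 = `erel_slice_nonneg`) with the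
integrated comonotone certificate `comonotone_nonneg_levelTwo` (P2) gives the pair-stability inequality CS₂ for the
glued vertex `u ∪ v` of two two-port stars whenever `j ≤ 2` and the champion `c` is off the four ports — in particular at
the rung `(|A|, j) = (5, 2)` of the crux chain.  No definitions, no named facts, no sorries.
-/

noncomputable section

namespace Summit.CriticalPhenomena.PercolationContinuityZ3.Theorems

open MeasureTheory Set Literature.Probability.LatticeModels Literature.Probability.Percolation
open scoped Classical BigOperators

variable {n : ℕ}

namespace TwoPortPeeling

/-- **MS-STAR₂₂ at level `j ≤ 2` (unconditional).**  Two two-port stars `u = {a, a'}`, `v = {b, b'}` glued onto `A`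
(hubs outside `A` with no other open pair, ports pairwise distinct), a champion `c ∈ A` of the glued graph off the four
ports, and `j ≤ 2`: then `P(ℓ(u, v; c)) ≤ P(ρ(u, v; c))`, i.e. the champion-stability pair inequality CS₂ holds for
merging `u` and `v`.  [this file; memo TWO-PORT-PEELING.md §5] -/
theorem championStabilityPair_twoStars_levelTwo (w : Sym2 (Fin n) → unitInterval) (A : Finset (Fin n))
    (u v a a' b b' c : Fin n) (j : ℕ) (hj : j ≤ 2) (hu : u ∉ A) (hv : v ∉ A) (huv : u ≠ v)
    (ha : a ∈ A) (ha' : a' ∈ A) (hb : b ∈ A) (hb' : b' ∈ A) (hc : c ∈ A)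
    (haa' : a ≠ a') (hbb' : b ≠ b') (hab : a ≠ b) (hab' : a ≠ b') (ha'b : a' ≠ b) (ha'b' : a' ≠ b')
    (hca : c ≠ a) (hca' : c ≠ a') (hcb : c ≠ b) (hcb' : c ≠ b')
    (hutwo : ∀ y : Fin n, y ≠ u → y ≠ a → y ≠ a' → w s(u, y) = 0)
    (hvtwo : ∀ y : Fin n, y ≠ v → y ≠ b → y ≠ b' → w s(v, y) = 0)
    (hchamp : ∀ x ∈ A,
      (prodBernoulli w).real {ω : BondConfig (Fin n) | (A.filter fun z => ω ∈ openConn x z).card ≤ j} ≤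
        (prodBernoulli w).real {ω : BondConfig (Fin n) | (A.filter fun z => ω ∈ openConn c z).card ≤ j}) :
    (prodBernoulli w).real {ω : BondConfig (Fin n) | ω ∉ openConn c u ∧ ω ∉ openConn c v ∧ 1 ≤ (A.filter fun z => ω ∈ openConn u z ∨ ω ∈ openConn v z).card ∧ (A.filter fun z => ω ∈ openConn u z ∨ ω ∈ openConn v z).card ≤ j} ≤
      (prodBernoulli w).real {ω : BondConfig (Fin n) | ω ∉ openConn c u ∧ ω ∉ openConn c v ∧ (A.filter fun z => ω ∈ openConn c z).card ≤ j} :=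
  championStabilityPair_twoStars_of_comonotone w A u v a a' b b' c j hu hv huv ha ha' hb hb' hc haa' hbb' hab hab'
    ha'b ha'b' hcb hcb' hutwo hvtwo (Or.inl hj) hchamp
    (comonotone_nonneg_levelTwo w A u v a a' b b' c j hj hu hv huv ha ha' hb hb' hc haa' hbb' hab hab' ha'b ha'b'
      hca hca' hcb hcb' hutwo hvtwo (hchamp a ha) (hchamp b hb))

end TwoPortPeeling

end Summit.CriticalPhenomena.PercolationContinuityZ3.Theorems
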